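import Literature.NumberTheory.LFunctions.SuzukiScrewLineExplicitHalfProofs
import Literature.NumberTheory.LFunctions.SuzukiScrewTestFunctionArchProofs
import Literature.NumberTheory.LFunctions.SuzukiScrewLinePinningProofs
import HarnessLib

/-!
# CJM Prop 3.1 (`𝔓_t = P_t`): the discharge `Suzuki2025_prop31_holds`

LINE 1 — LABEL: RH-FREE DISCHARGE of the named fact `Literature.NumberTheory.LFunctions.Suzuki2025_prop31`
(M. Suzuki, Canad. J. Math. 2025 = arXiv:2301.00421v3, **Prop 3.1**: the meromorphic functions `𝔓_t` of
(1.6) and `P_t` of (3.2) coincide). Assembly of the pieces of the printed proof (TeX l.794–980):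
* explicit formula (3.3) in Bombieri's form for continuous compactly supported Lipschitz test functions
  (`explicit_formula_continuous_bombieri`, dbl-t6 g4) applied to `g = c_tφ_{z,t} − c_{t′}φ_{z,t′}`
  (`SuzukiScrewTestFunction.lean`: zero side, polar and prime terms; `SuzukiScrewLineExplicitHalfProofs.lean`:
  `hZ`, `hA` and the assembly `ScrewExplicitHalf.coeff_mul_sub_eq_of_arch`, dbl-t6 g4);
* the Bombieri archimedean term of `g` (`SuzukiTestFunctionArch.weilArchTermBombieri_suzukiPhiC`, dbl-t7 g2);
* the pinning `c_t(𝔓_t − P_t)` constant in `t` ⇒ `𝔓_t = P_t` and analytic continuation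
  (`Suzuki2025_prop31_of_sub_eq_const_mul`, `SuzukiScrewLinePinningProofs.lean`, dbl-t7 g2).
bears_on: B-C/B-P (COLUMN 6 DBR). WHAT THIS IS NOT: an identity between two RH-free meromorphic functions
(the F-input of CJM Thm 4.2); nothing here bears on the truth of RH.

## References

* M. Suzuki, *On the Hilbert space derived from the Weil distribution*, Canad. J. Math. (2025)
  = arXiv:2301.00421v3, Prop. 3.1 and its proof (TeX l.789–980). [Suzuki2025WeilHilbertSpace]
-/

noncomputable section

open Complex

namespace Literature.NumberTheory.LFunctions

/-- RH-FREE · **CJM Prop 3.1, PROVED**: `𝔓_t = P_t` as typed (`Suzuki2025_prop31`).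
[cite: Suzuki2025WeilHilbertSpace, Prop. 3.1 (TeX l.789–793), proof TeX l.794–980] -/
theorem Suzuki2025_prop31_holds : Suzuki2025_prop31 := by
  refine Suzuki2025_prop31_of_sub_eq_const_mul fun z hz ↦ ?_
  have hz0 : 0 < z.im := zero_lt_one.trans hz
  have h1 := cexp_neg_I_mul_ne_one hz0 one_pos
  -- the `t`-independent value `C := c_1(𝔓_1(z) − P_1(z))`
  refine ⟨suzukiPhiCoeff z 1 * (screwP 1 z - screwZeroExpansion 1 z), fun t ht ↦ ?_⟩
  have hct := cexp_neg_I_mul_ne_one hz0 ht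
  -- `c_t(𝔓_t − P_t) = c_1(𝔓_1 − P_1)` from the explicit formula for the compact combinations
  have key : suzukiPhiCoeff z t * (screwP t z - screwZeroExpansion t z) =
      suzukiPhiCoeff z 1 * (screwP 1 z - screwZeroExpansion 1 z) := by
    rcases le_total t 1 with h | h
    · exact ScrewExplicitHalf.coeff_mul_sub_eq_of_arch hz ht h (by
        rw [SuzukiTestFunctionArch.weilArchTermBombieri_suzukiPhiC hz0 ht one_pos]; ring)
    · exact (ScrewExplicitHalf.coeff_mul_sub_eq_of_arch hz one_pos h (by
        rw [SuzukiTestFunctionArch.weilArchTermBombieri_suzukiPhiC hz0 one_pos ht]; ring)).symm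
  have hc := suzukiPhiCoeff_mul z hct
  calc screwP t z - screwZeroExpansion t z
      = suzukiPhiCoeff z t * (cexp (-(I * z * t)) - 1) * (screwP t z - screwZeroExpansion t z) := by
        rw [hc, one_mul]
    _ = suzukiPhiCoeff z t * (screwP t z - screwZeroExpansion t z) * (cexp (-(I * z * t)) - 1) := by ring
    _ = suzukiPhiCoeff z 1 * (screwP 1 z - screwZeroExpansion 1 z) * (cexp (-(I * z * t)) - 1) := by
        rw [key]

end Literature.NumberTheory.LFunctions

end
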